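import Literature.Topology.FourManifolds.GeneralPush
import Literature.Topology.FourManifolds.FoldPushCharts
import HarnessLib

/-!
# The general push: fold charts and Whitney cusp charts persist, injectivity persists

Topic `Literature/Topology/FourManifolds` (programme of the fact
`Literature.Topology.FourManifolds.exists_isSimplifiedBrokenLefschetzFibration`, Baykur–Saeki 2017, §2.1,
§3).  Companion of `GeneralPush`: on the open set `V` where the bump is `ρ ∘ ψ ∘ g`, the
pushed map is `ψ⁻¹ ∘ T_θ ∘ ψ ∘ g` with `T_θ` an injective local diffeomorphism of the plane
(`PlanePush`), so at points of `V`

* fold charts of `g` give fold charts of `g_θ` (`GeneralPush.hasManifoldFoldChart_pushed`);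
* Whitney cusp charts of `g` give Whitney cusp charts of `g_θ`
  (`GeneralPush.hasManifoldWhitneyCuspCharts_pushed`);
* `g_θ` is injective on any subset of `V` on which `g` is (`GeneralPush.injOn_pushed`).

On the way: manifold fold / cusp charts give fold charts / Whitney cusp data of the local
representative in any pair of smooth charts (`hasFoldChartSig_rep_of_hasManifoldFoldChart`,
`hasWhitneyCuspData_rep_of_hasManifoldWhitneyCuspCharts`), and Whitney cusp data pass through
target local diffeomorphisms (`HasWhitneyCuspData.comp_localDiffeo`).

Everything is proved; no definitions, no named facts (D-0026).

## References

* R. İ. Baykur, O. Saeki, *Simplifying indefinite fibrations on 4-manifolds*, arXiv:1705.11169,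
  §2.1 p. 6, §3. [BaykurSaeki2017]
* M. Golubitsky, V. Guillemin, *Stable Mappings and Their Singularities*, GTM 14 (1973), Ch. III
  §4, Ch. VI §2. [GolubitskyGuillemin1973]
-/

noncomputable section

set_option maxSynthPendingDepth 2

open Set Function Filter Module Metric
open scoped ContDiff Topology Manifold

namespace Literature.Topology.FourManifolds

/-- Local notation: `𝔼 n` is the model Euclidean space `EuclideanSpace ℝ (Fin n)`. -/
local notation "𝔼 " n:arg => EuclideanSpace ℝ (Fin n)

variable {X : Type*} [TopologicalSpace X] [ChartedSpace (𝔼 4) X]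
  {B : Type*} [TopologicalSpace B] [ChartedSpace (𝔼 2) B]

/-! ### Manifold charts give charts of the local representative -/

/-- **From a manifold fold chart to a fold chart of the local representative** (converse of
`exists_foldChartSig_of_hasFoldChartSig`). [cite: BaykurSaeki2017, §2.1] -/
theorem hasFoldChartSig_rep_of_hasManifoldFoldChart {f : X → B}
    {Φ₀ : OpenPartialHomeomorph X (𝔼 4)} {Ψ₀ : OpenPartialHomeomorph B (𝔼 2)}
    (hΦ₀ : ContMDiffOn (𝓡 4) (𝓡 4) ∞ Φ₀ Φ₀.source)
    (hΦ₀s : ContMDiffOn (𝓡 4) (𝓡 4) ∞ Φ₀.symm Φ₀.target)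
    (hΨ₀ : ContMDiffOn (𝓡 2) (𝓡 2) ∞ Ψ₀ Ψ₀.source)
    (hΨ₀s : ContMDiffOn (𝓡 2) (𝓡 2) ∞ Ψ₀.symm Ψ₀.target)
    (hmaps : MapsTo f Φ₀.source Ψ₀.source) {p : X} (hp : p ∈ Φ₀.source)
    (h : HasManifoldFoldChart f p) :
    ∃ s₁ s₂ s₃ : ℝ, s₁ ^ 2 = 1 ∧ s₂ ^ 2 = 1 ∧ s₃ ^ 2 = 1 ∧
      HasFoldChartSig (Ψ₀ ∘ f ∘ Φ₀.symm) (Φ₀ p) s₁ s₂ s₃ := by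
  obtain ⟨s₁, s₂, s₃, φ, ψ, hs₁, hs₂, hs₃, hpφ, hp0, hmapsφ, hφ, hφs, hψ, hψs, hid⟩ := h
  refine ⟨s₁, s₂, s₃, hs₁, hs₂, hs₃, ?_⟩
  set φ' : OpenPartialHomeomorph (𝔼 4) (𝔼 4) := Φ₀.symm.trans φ with hφ'
  set ψ' : OpenPartialHomeomorph (𝔼 2) (𝔼 2) := Ψ₀.symm.trans ψ with hψ'
  refine ⟨φ', ψ', ?_, ?_, ?_, ?_, ?_, ?_, ?_, ?_⟩
  · rw [hφ', OpenPartialHomeomorph.trans_source]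
    refine ⟨Φ₀.map_source hp, ?_⟩
    show Φ₀.symm (Φ₀ p) ∈ φ.source
    rw [Φ₀.left_inv hp]; exact hpφ
  · show φ (Φ₀.symm (Φ₀ p)) = 0
    rw [Φ₀.left_inv hp]; exact hp0
  · intro y hy
    rw [hφ', OpenPartialHomeomorph.trans_source] at hy
    rw [hψ', OpenPartialHomeomorph.trans_source]
    refine ⟨Ψ₀.map_source (hmaps (Φ₀.map_target hy.1)), ?_⟩
    show Ψ₀.symm (Ψ₀ (f (Φ₀.symm y))) ∈ ψ.source
    rw [Ψ₀.left_inv (hmaps (Φ₀.map_target hy.1))]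
    exact hmapsφ hy.2
  · rw [hφ', OpenPartialHomeomorph.trans_source, OpenPartialHomeomorph.coe_trans]
    exact contMDiffOn_iff_contDiffOn.1
      (hφ.comp (hΦ₀s.mono inter_subset_left) fun y hy => hy.2)
  · rw [hφ', OpenPartialHomeomorph.trans_symm_eq_symm_trans_symm,
      OpenPartialHomeomorph.trans_target, OpenPartialHomeomorph.coe_trans,
      OpenPartialHomeomorph.symm_symm]
    exact contMDiffOn_iff_contDiffOn.1
      (hΦ₀.comp (hφs.mono inter_subset_left) fun y hy => hy.2)
  · rw [hψ', OpenPartialHomeomorph.trans_source, OpenPartialHomeomorph.coe_trans]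
    exact contMDiffOn_iff_contDiffOn.1
      (hψ.comp (hΨ₀s.mono inter_subset_left) fun y hy => hy.2)
  · rw [hψ', OpenPartialHomeomorph.trans_symm_eq_symm_trans_symm,
      OpenPartialHomeomorph.trans_target, OpenPartialHomeomorph.coe_trans,
      OpenPartialHomeomorph.symm_symm]
    exact contMDiffOn_iff_contDiffOn.1
      (hΨ₀.comp (hψs.mono inter_subset_left) fun y hy => hy.2)
  · intro y hy
    rw [hφ', OpenPartialHomeomorph.trans_source] at hy
    have hq : Φ₀.symm y ∈ Φ₀.source := Φ₀.map_target hy.1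
    simp only [hφ', hψ', OpenPartialHomeomorph.coe_trans, Function.comp_apply,
      Ψ₀.left_inv (hmaps hq)]
    exact hid _ hy.2

/-- **From manifold Whitney cusp charts to Whitney cusp data of the local representative**
(converse of `exists_whitneyCuspCharts_of_hasWhitneyCuspData`). [cite: BaykurSaeki2017, §2.1] -/
theorem hasWhitneyCuspData_rep_of_hasManifoldWhitneyCuspCharts {f : X → B}
    {Φ₀ : OpenPartialHomeomorph X (𝔼 4)} {Ψ₀ : OpenPartialHomeomorph B (𝔼 2)}
    (hΦ₀ : ContMDiffOn (𝓡 4) (𝓡 4) ∞ Φ₀ Φ₀.source)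
    (hΦ₀s : ContMDiffOn (𝓡 4) (𝓡 4) ∞ Φ₀.symm Φ₀.target)
    (hΨ₀ : ContMDiffOn (𝓡 2) (𝓡 2) ∞ Ψ₀ Ψ₀.source)
    (hΨ₀s : ContMDiffOn (𝓡 2) (𝓡 2) ∞ Ψ₀.symm Ψ₀.target)
    (hmaps : MapsTo f Φ₀.source Ψ₀.source) {p : X} (hp : p ∈ Φ₀.source)
    (h : HasManifoldWhitneyCuspCharts f p) :
    HasWhitneyCuspData (Ψ₀ ∘ f ∘ Φ₀.symm) (Φ₀ p) := by
  obtain ⟨φ, ψ, hh, U, ε₂, ε₃, hpφ, hp0, hmapsφ, hφ, hφs, hψ, hψs, hU, hhs, hφU, hε₂, hε₃, hid,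
    w0, w1, w2, w3, w4, w5⟩ := h
  set φ' : OpenPartialHomeomorph (𝔼 4) (𝔼 4) := Φ₀.symm.trans φ with hφ'
  set ψ' : OpenPartialHomeomorph (𝔼 2) (𝔼 2) := Ψ₀.symm.trans ψ with hψ'
  refine ⟨φ', ψ', hh, U, ε₂, ε₃, ?_, ?_, ?_, ?_, ?_, ?_, ?_, hU, hhs, ?_, hε₂, hε₃, ?_,
    w0, w1, w2, w3, w4, w5⟩
  · rw [hφ', OpenPartialHomeomorph.trans_source]
    refine ⟨Φ₀.map_source hp, ?_⟩
    show Φ₀.symm (Φ₀ p) ∈ φ.source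
    rw [Φ₀.left_inv hp]; exact hpφ
  · show φ (Φ₀.symm (Φ₀ p)) = 0
    rw [Φ₀.left_inv hp]; exact hp0
  · intro y hy
    rw [hφ', OpenPartialHomeomorph.trans_source] at hy
    rw [hψ', OpenPartialHomeomorph.trans_source]
    refine ⟨Ψ₀.map_source (hmaps (Φ₀.map_target hy.1)), ?_⟩
    show Ψ₀.symm (Ψ₀ (f (Φ₀.symm y))) ∈ ψ.source
    rw [Ψ₀.left_inv (hmaps (Φ₀.map_target hy.1))]
    exact hmapsφ hy.2
  · rw [hφ', OpenPartialHomeomorph.trans_source, OpenPartialHomeomorph.coe_trans]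
    exact contMDiffOn_iff_contDiffOn.1
      (hφ.comp (hΦ₀s.mono inter_subset_left) fun y hy => hy.2)
  · rw [hφ', OpenPartialHomeomorph.trans_symm_eq_symm_trans_symm,
      OpenPartialHomeomorph.trans_target, OpenPartialHomeomorph.coe_trans,
      OpenPartialHomeomorph.symm_symm]
    exact contMDiffOn_iff_contDiffOn.1
      (hΦ₀.comp (hφs.mono inter_subset_left) fun y hy => hy.2)
  · rw [hψ', OpenPartialHomeomorph.trans_source, OpenPartialHomeomorph.coe_trans]
    exact contMDiffOn_iff_contDiffOn.1
      (hψ.comp (hΨ₀s.mono inter_subset_left) fun y hy => hy.2)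
  · rw [hψ', OpenPartialHomeomorph.trans_symm_eq_symm_trans_symm,
      OpenPartialHomeomorph.trans_target, OpenPartialHomeomorph.coe_trans,
      OpenPartialHomeomorph.symm_symm]
    exact contMDiffOn_iff_contDiffOn.1
      (hΨ₀.comp (hψs.mono inter_subset_left) fun y hy => hy.2)
  · intro y hy
    rw [hφ', OpenPartialHomeomorph.trans_source] at hy
    simp only [hφ', OpenPartialHomeomorph.coe_trans, Function.comp_apply]
    exact hφU _ hy.2
  · intro y hy
    rw [hφ', OpenPartialHomeomorph.trans_source] at hy
    have hq : Φ₀.symm y ∈ Φ₀.source := Φ₀.map_target hy.1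
    simp only [hφ', hψ', OpenPartialHomeomorph.coe_trans, Function.comp_apply,
      Ψ₀.left_inv (hmaps hq)]
    exact hid _ hy.2

/-! ### Whitney cusp data pass through target local diffeomorphisms -/

/-- **Composition with a local diffeomorphism of the target preserves Whitney cusp data.**
[folklore] -/
theorem HasWhitneyCuspData.comp_localDiffeo {F : 𝔼 4 → 𝔼 2} {y : 𝔼 4}
    (h : HasWhitneyCuspData F y) (hF : Continuous F) (G : OpenPartialHomeomorph (𝔼 2) (𝔼 2))
    (hG : ContDiffOn ℝ ∞ G G.source) (hGs : ContDiffOn ℝ ∞ G.symm G.target) (hy : F y ∈ G.source) :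
    HasWhitneyCuspData (G ∘ F) y := by
  obtain ⟨φ, ψ, hh, U, ε₂, ε₃, hyφ, hy0, hmaps, hφ, hφs, hψ, hψs, hU, hhs, hφU, hε₂, hε₃, hid,
    w0, w1, w2, w3, w4, w5⟩ := h
  have hSo : IsOpen (F ⁻¹' G.source) := G.open_source.preimage hF
  set φ' := φ.restrOpen (F ⁻¹' G.source) hSo with hφ'
  have hsrc : φ'.source = φ.source ∩ F ⁻¹' G.source :=
    OpenPartialHomeomorph.restrOpen_source φ _ hSo
  have htgt : φ'.target ⊆ φ.target := fun z hz => hz.1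
  refine ⟨φ', G.symm.trans ψ, hh, U, ε₂, ε₃, ?_, hy0, ?_, ?_, hφs.mono htgt, ?_, ?_, hU, hhs,
    ?_, hε₂, hε₃, ?_, w0, w1, w2, w3, w4, w5⟩
  · rw [hsrc]; exact ⟨hyφ, hy⟩
  · intro q hq
    rw [hsrc] at hq
    rw [OpenPartialHomeomorph.trans_source]
    refine ⟨G.map_source hq.2, ?_⟩
    show G.symm (G (F q)) ∈ ψ.source
    rw [G.left_inv hq.2]
    exact hmaps hq.1
  · rw [hsrc]; exact hφ.mono inter_subset_left
  · rw [OpenPartialHomeomorph.trans_source, OpenPartialHomeomorph.coe_trans]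
    exact hψ.comp (hGs.mono inter_subset_left) fun w hw => hw.2
  · rw [OpenPartialHomeomorph.trans_symm_eq_symm_trans_symm, OpenPartialHomeomorph.trans_target,
      OpenPartialHomeomorph.coe_trans, OpenPartialHomeomorph.symm_symm]
    exact hG.comp (hψs.mono inter_subset_left) fun w hw => hw.2
  · intro q hq
    rw [hsrc] at hq
    exact hφU q hq.1
  · intro q hq
    rw [hsrc] at hq
    simp only [OpenPartialHomeomorph.coe_trans, Function.comp_apply, G.left_inv hq.2]
    exact hid q hq.1

/-! ### Persistence under the general push -/

namespace GeneralPush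

variable {g : X → B} {ψ : OpenPartialHomeomorph B (𝔼 2)} {b : X → ℝ} {θ : 𝔼 2}
  {ρ : 𝔼 2 → ℝ} {C : ℝ} {V : Set X}

/-- A smooth chart of `X` inside `V` at `q`, the smooth representative `ψ ∘ g ∘ Φ₀⁻¹`, and the
representative of the pushed map `T_θ ∘ (ψ ∘ g ∘ Φ₀⁻¹)`. [folklore] -/
theorem exists_chart_rep [IsManifold (𝓡 4) ∞ X] (hg : ContMDiff (𝓡 4) (𝓡 2) ∞ g)
    (hψ : ContMDiffOn (𝓡 2) (𝓡 2) ∞ ψ ψ.source) (hV : IsOpen V) (hVs : V ⊆ g ⁻¹' ψ.source)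
    (hVb : ∀ q ∈ V, b q = ρ (ψ (g q)))
    (hθt : ∀ q, g q ∈ ψ.source → ψ (g q) + b q • θ ∈ ψ.target) {q : X} (hq : q ∈ V) :
    ∃ Φ₀ : OpenPartialHomeomorph X (𝔼 4), q ∈ Φ₀.source ∧ Φ₀.source ⊆ V ∧
      ContMDiffOn (𝓡 4) (𝓡 4) ∞ Φ₀ Φ₀.source ∧ ContMDiffOn (𝓡 4) (𝓡 4) ∞ Φ₀.symm Φ₀.target ∧
      MapsTo g Φ₀.source ψ.source ∧ MapsTo (pushed g ψ b θ) Φ₀.source ψ.source ∧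
      ContDiffOn ℝ ∞ (ψ ∘ g ∘ Φ₀.symm) Φ₀.target ∧
      ∀ y ∈ Φ₀.target, (ψ ∘ pushed g ψ b θ ∘ Φ₀.symm) y =
        PlanePush.T ρ θ ((ψ ∘ g ∘ Φ₀.symm) y) := by
  set Φ₀ := (chartAt (𝔼 4) q).restrOpen V hV with hΦ₀
  have hmaps : MapsTo g Φ₀.source ψ.source := fun q' hq' => hVs hq'.2
  have hΦ₀s : ContMDiffOn (𝓡 4) (𝓡 4) ∞ Φ₀.symm Φ₀.target :=
    (contMDiffOn_chart_symm (x := q)).mono fun y hy => hy.1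
  refine ⟨Φ₀, ⟨mem_chart_source _ q, hq⟩, inter_subset_right,
    (contMDiffOn_chart (x := q)).mono inter_subset_left, hΦ₀s, hmaps,
    fun q' hq' => (apply_pushed hθt (hmaps hq')).1, ?_, fun y hy => ?_⟩
  · exact contMDiffOn_iff_contDiffOn.1
      (hψ.comp (hg.comp_contMDiffOn hΦ₀s) fun y hy => hmaps (Φ₀.map_target hy))
  · have hq' : Φ₀.symm y ∈ V := (Φ₀.map_target hy).2
    simp only [Function.comp_apply]
    rw [(apply_pushed hθt (hVs hq')).2, hVb _ hq', PlanePush.T]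

/-- **Fold charts persist under the general push** at points of `V`, for `C‖θ‖ < 1` within the
margin. [cite: BaykurSaeki2017, §2.1 p. 6, §3] -/
theorem hasManifoldFoldChart_pushed [IsManifold (𝓡 4) ∞ X] (hg : ContMDiff (𝓡 4) (𝓡 2) ∞ g)
    (hψ : ContMDiffOn (𝓡 2) (𝓡 2) ∞ ψ ψ.source) (hψs : ContMDiffOn (𝓡 2) (𝓡 2) ∞ ψ.symm ψ.target)
    (hρ : ContDiff ℝ ∞ ρ) (hC : ∀ w, ‖fderiv ℝ ρ w‖ ≤ C)
    (hV : IsOpen V) (hVs : V ⊆ g ⁻¹' ψ.source) (hVb : ∀ q ∈ V, b q = ρ (ψ (g q)))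
    (hθC : C * ‖θ‖ < 1) (hθt : ∀ q, g q ∈ ψ.source → ψ (g q) + b q • θ ∈ ψ.target)
    {q : X} (hq : q ∈ V) (hfold : HasManifoldFoldChart g q) :
    HasManifoldFoldChart (pushed g ψ b θ) q := by
  obtain ⟨Φ₀, hqΦ, -, hΦ₀, hΦ₀s, hmaps, hPmaps, hrep, hrepP⟩ :=
    exists_chart_rep hg hψ hV hVs hVb hθt hq
  set R : 𝔼 4 → 𝔼 2 := ψ ∘ g ∘ Φ₀.symm with hR
  obtain ⟨s₁, s₂, s₃, hs₁, hs₂, hs₃, h0⟩ :=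
    hasFoldChartSig_rep_of_hasManifoldFoldChart hΦ₀ hΦ₀s hψ hψs hmaps hqΦ hfold
  have hy : Φ₀ q ∈ Φ₀.target := Φ₀.map_source hqΦ
  obtain ⟨Rh, hRh, hRhR⟩ := exists_contDiff_eventuallyEq_planeRep Φ₀.open_target hrep hy
  have h1 : HasFoldChartSig Rh (Φ₀ q) s₁ s₂ s₃ := h0.congr_of_eventuallyEq hRhR.symm
  obtain ⟨G, hGT, hw₀, hGs, hGss⟩ := PlanePush.exists_localInverse_T hρ hC hθC (Rh (Φ₀ q))
  have h2 : HasFoldChartSig (G ∘ Rh) (Φ₀ q) s₁ s₂ s₃ :=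
    h1.comp_localDiffeo hRh.continuous G hGs hGss hw₀
  have h3 : HasFoldChartSig (ψ ∘ pushed g ψ b θ ∘ Φ₀.symm) (Φ₀ q) s₁ s₂ s₃ := by
    refine h2.congr_of_eventuallyEq ?_
    filter_upwards [hRhR, Φ₀.open_target.mem_nhds hy] with y hyR hyt
    rw [Function.comp_apply, hGT, hyR, hrepP y hyt]
  obtain ⟨φ', ψ', c1, c2, c3, c4, c5, c6, c7, c8⟩ :=
    exists_foldChartSig_of_hasFoldChartSig hΦ₀ hΦ₀s hψ hψs hPmaps hqΦ h3
  exact ⟨s₁, s₂, s₃, φ', ψ', hs₁, hs₂, hs₃, c1, c2, c3, c4, c5, c6, c7, c8⟩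

/-- **Whitney cusp charts persist under the general push** at points of `V`, for `C‖θ‖ < 1`
within the margin. [cite: BaykurSaeki2017, §2.1 p. 6, §3] -/
theorem hasManifoldWhitneyCuspCharts_pushed [IsManifold (𝓡 4) ∞ X]
    (hg : ContMDiff (𝓡 4) (𝓡 2) ∞ g)
    (hψ : ContMDiffOn (𝓡 2) (𝓡 2) ∞ ψ ψ.source) (hψs : ContMDiffOn (𝓡 2) (𝓡 2) ∞ ψ.symm ψ.target)
    (hρ : ContDiff ℝ ∞ ρ) (hC : ∀ w, ‖fderiv ℝ ρ w‖ ≤ C)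
    (hV : IsOpen V) (hVs : V ⊆ g ⁻¹' ψ.source) (hVb : ∀ q ∈ V, b q = ρ (ψ (g q)))
    (hθC : C * ‖θ‖ < 1) (hθt : ∀ q, g q ∈ ψ.source → ψ (g q) + b q • θ ∈ ψ.target)
    {q : X} (hq : q ∈ V) (hW : HasManifoldWhitneyCuspCharts g q) :
    HasManifoldWhitneyCuspCharts (pushed g ψ b θ) q := by
  obtain ⟨Φ₀, hqΦ, -, hΦ₀, hΦ₀s, hmaps, hPmaps, hrep, hrepP⟩ :=
    exists_chart_rep hg hψ hV hVs hVb hθt hq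
  set R : 𝔼 4 → 𝔼 2 := ψ ∘ g ∘ Φ₀.symm with hR
  have h0 := hasWhitneyCuspData_rep_of_hasManifoldWhitneyCuspCharts hΦ₀ hΦ₀s hψ hψs hmaps hqΦ hW
  have hy : Φ₀ q ∈ Φ₀.target := Φ₀.map_source hqΦ
  obtain ⟨Rh, hRh, hRhR⟩ := exists_contDiff_eventuallyEq_planeRep Φ₀.open_target hrep hy
  have h1 : HasWhitneyCuspData Rh (Φ₀ q) := h0.congr_of_eventuallyEq hRhR.symm
  obtain ⟨G, hGT, hw₀, hGs, hGss⟩ := PlanePush.exists_localInverse_T hρ hC hθC (Rh (Φ₀ q))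
  have h2 : HasWhitneyCuspData (G ∘ Rh) (Φ₀ q) := h1.comp_localDiffeo hRh.continuous G hGs hGss hw₀
  have h3 : HasWhitneyCuspData (ψ ∘ pushed g ψ b θ ∘ Φ₀.symm) (Φ₀ q) := by
    refine h2.congr_of_eventuallyEq ?_
    filter_upwards [hRhR, Φ₀.open_target.mem_nhds hy] with y hyR hyt
    rw [Function.comp_apply, hGT, hyR, hrepP y hyt]
  obtain ⟨φ', ψ', h', U, ε₂, ε₃, rest⟩ :=
    exists_whitneyCuspCharts_of_hasWhitneyCuspData hΦ₀ hΦ₀s hψ hψs hPmaps hqΦ h3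
  exact ⟨φ', ψ', h', U, ε₂, ε₃, rest⟩

omit [TopologicalSpace X] [ChartedSpace (𝔼 4) X] [ChartedSpace (𝔼 2) B] in
/-- **Injectivity persists**: the pushed map is injective on every subset of `V` on which `g`
is, when `T_θ` is injective (`C‖θ‖ < 1`). [folklore] -/
theorem injOn_pushed (hρ : ContDiff ℝ ∞ ρ) (hC : ∀ w, ‖fderiv ℝ ρ w‖ ≤ C)
    (hVs : V ⊆ g ⁻¹' ψ.source) (hVb : ∀ q ∈ V, b q = ρ (ψ (g q))) (hθC : C * ‖θ‖ < 1)
    (hθt : ∀ q, g q ∈ ψ.source → ψ (g q) + b q • θ ∈ ψ.target)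
    {A : Set X} (hAV : A ⊆ V) (hinj : InjOn g A) : InjOn (pushed g ψ b θ) A := by
  intro q hq q' hq' hqq'
  have h1 : ∀ x ∈ A, ψ (pushed g ψ b θ x) = PlanePush.T ρ θ (ψ (g x)) := fun x hx => by
    rw [(apply_pushed hθt (hVs (hAV hx))).2, hVb x (hAV hx), PlanePush.T]
  have h2 : ψ (g q) = ψ (g q') :=
    PlanePush.injective_T hρ hC hθC (by rw [← h1 q hq, ← h1 q' hq', hqq'])
  have h3 : g q = g q' := by
    rw [← ψ.left_inv (hVs (hAV hq)), ← ψ.left_inv (hVs (hAV hq')), h2]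
  exact hinj hq hq' h3

end GeneralPush

end Literature.Topology.FourManifolds
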